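import Literature.NumberTheory.DiophantineGeometry.AVKernelHopf
import HarnessLib

/-!
# A finite closed subgroup scheme `Z ⊂ A` of an abelian variety over a field is killed by its order:
# `Z ⊆ A[n]`, `n = dim_K Γ(Z, 𝒪)` (Deligne; Görtz–Wedhorn II, Prop. 27.86, §(27.2), (27.1.1))

Layer `Literature/AlgebraicGeometry/Motives`, namespace `Literature.AlgebraicGeometry.Motives.AbelianVariety`.  Cell `hodgecm-mathlib`
(D-0151), F-DAG leaf F-2c «étaleness of `K(L) → S`», file U1 of B-p08 (g12)՚s census 2026-08-30T06:51Z (sequencer B-plan1 (g16)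
06:49:21Z GO).  The tree՚s ★ `NumberTheory/DiophantineGeometry/AVKernelHopf` runs DELIGNE՚s theorem ([GortzWedhorn2023] Prop. 27.86, ★
`Deligne.convPow_finrank_eq_one`) for the KERNEL `Ker f` of a finite homomorphism of abelian varieties; this file re-runs the same
three steps (points ↔ `K`-algebra maps of the affine algebra, functorial group law ⇒ Hopf algebra via ★ `CorepGroupLaw`, Deligne at the
universal point) for an ARBITRARY finite closed subgroup scheme of `A` presented the way the tree՚s seesaw/`K(L)` files present it
(★ `AbelianSchemes/AbelianSchemeKOfLSeesaw.exists_isClosedImmersion_subgroup_iff_memKOfL`, ★ `…KOfLClosedSubscheme`): a closed immersion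
`ι : Z ↪ A` over `K`, `Z → Spec K` finite, through which the unit, the product of the two projections `Z × Z ⇉ A` and the inverse
of `ι` factor.
* `FiniteSubgroupSubscheme A` — that datum (a `structure`; no instance on anything but its own fields՚ carriers);
* `D.points T : Subgroup (T ⟶ A.X)` — the `T`-valued points of `A` factoring through `ι` (a subgroup by the three factorisations);
  `D.lift`, `D.lift_comp_emb`, functoriality `D.pointsComap`;
* `D.Alg = Γ(Z, 𝒪)` with its `K`-algebra structure (`algebraMapΓ`), finite-dimensional; `D.order := dim_K Γ(Z, 𝒪) > 0`;
* `D.ptEquiv R' : D.points (Spec R') ≃ (Γ(Z, 𝒪) →ₐ[K] R')`, natural in the `K`-algebra `R'` (`ptEquiv_comap`);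
* `D.groupLaw : CorepGroupLaw K (D.Alg)` ⇒ instances `HopfAlgebra K D.Alg`, `Coalgebra.IsCocomm K D.Alg` (as ★ `Hom.KerAlg.*`);
* **`D.pt_pow_order`**, **`D.emb_pow_order : D.emb ^ D.order = 1`**, **`D.comp_emb_pow_order (v : T ⟶ Z) : (v ≫ ι) ^ D.order = 1`**,
  **`D.points_le_kerPoints_nsmul : D.points T ≤ Ker [n]_A (T)`** — DELIGNE: a finite closed subgroup scheme of an abelian variety is
  killed by its order `n` and lies in `A[n]`.
With ★-to-be `Motives/AbelianVarietyTorsionSubschemeEtale.etale_hom_of_pow_eq_one` (file U2) this makes `Z` ÉTALE over `K` whenever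
`n ∈ K^×` (e.g. `char K = 0`) — without Cartier՚s theorem.  THEOREMS + one structure + the ★-style instances on the structure՚s own carrier
`D.Alg`; no named fact, no `sorry`.  HC_CM is proved only modulo the 7 printed citations until rung 0 closes; this file asserts nothing about HC.

## References
* [GortzWedhorn2023] U. Görtz, T. Wedhorn, *Algebraic Geometry II* (2023): (27.1.1), §(27.2) (affine group schemes and Hopf algebras,
  p. 606–607), Prop. 27.86 (Deligne, p. 633), (27.35.1)–(27.35.2).
* [MumfordAV1970] D. Mumford, *Abelian Varieties* (1970), §11 and §19 Remark p. 169.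
* J. Tate, F. Oort, *Group schemes of prime order*, Ann. Sci. ÉNS 3 (1970), §1 (Deligne՚s theorem).
-/

set_option autoImplicit false

universe u

open CategoryTheory CategoryTheory.Limits AlgebraicGeometry MonoidalCategory CartesianMonoidalCategory TensorProduct WithConv

noncomputable section

namespace Literature.AlgebraicGeometry.Motives.AbelianVariety

open scoped MonObj

open Literature.NumberTheory.DiophantineGeometry

variable {K : Type u} [Field K]

/-- **A finite closed subgroup scheme of an abelian variety**, presented as in the tree՚s `K(L)` files: a closed immersion `ι : Z ↪ A`
over `K` with `Z → Spec K` finite, through which the unit, the product of the two projections and the inverse of `ι` factor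
([GortzWedhorn2023] (27.1.1): a subgroup functor represented by a closed subscheme). [cite: GortzWedhorn2023, (27.1.1) and §(27.2) (p. 606)] -/
structure FiniteSubgroupSubscheme (A : AbelianVariety K) where
  /-- The underlying `K`-scheme. -/
  Z : SchemeOver K
  /-- The inclusion `Z ↪ A`, over `K` (named `emb`: `ι` is Mathlib՚s scoped notation for the inverse of a group object). -/
  emb : Z ⟶ A.X
  /-- `ι` is a closed immersion. -/
  isClosedImmersion : IsClosedImmersion emb.left
  /-- `Z → Spec K` is finite. -/
  isFinite : IsFinite Z.hom
  /-- The unit factors through `Z`. -/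
  one_mem : ∃ e : 𝟙_ (SchemeOver K) ⟶ Z, e ≫ emb = 1
  /-- The product of the two projections `Z × Z ⇉ A` factors through `Z`. -/
  mul_mem : ∃ m : Z ⊗ Z ⟶ Z, m ≫ emb = (CartesianMonoidalCategory.fst Z Z ≫ emb) * (CartesianMonoidalCategory.snd Z Z ≫ emb)
  /-- The inverse of `emb` factors through `Z`. -/
  inv_mem : ∃ n : Z ⟶ Z, n ≫ emb = emb⁻¹

namespace FiniteSubgroupSubscheme

variable {A : AbelianVariety K} (D : FiniteSubgroupSubscheme A)

/-- `ι` is a monomorphism of `K`-schemes (a closed immersion). [cite: GortzWedhorn2023, (27.1.1)] -/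
theorem mono_emb : Mono D.emb :=
  haveI := D.isClosedImmersion
  Over.mono_of_mono_left D.emb

/-! ### The subgroup of `T`-valued points factoring through `Z` -/

section Points

variable (T : SchemeOver K)

/-- **`Z(T) ≤ A(T)`**: the `T`-valued points of `A` factoring through `ι : Z ↪ A`, a subgroup of `A(T)` (Mathlib՚s scoped `Hom.group`)
by the three factorisations of the datum ([GortzWedhorn2023] (27.1.1): `Z(T)` is a subgroup of `A(T)` for every `T`).
[cite: GortzWedhorn2023, (27.1.1) and §(27.2) (p. 606)] -/
def points : Subgroup (T ⟶ A.X) where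
  carrier := {u | ∃ v : T ⟶ D.Z, v ≫ D.emb = u}
  one_mem' := by
    obtain ⟨e, he⟩ := D.one_mem
    exact ⟨toUnit T ≫ e, by rw [Category.assoc, he, MonObj.comp_one]⟩
  mul_mem' := by
    rintro u u' ⟨v, rfl⟩ ⟨v', rfl⟩
    obtain ⟨m, hm⟩ := D.mul_mem
    refine ⟨CartesianMonoidalCategory.lift v v' ≫ m, ?_⟩
    rw [Category.assoc, hm, MonObj.comp_mul, ← Category.assoc, ← Category.assoc, CartesianMonoidalCategory.lift_fst,
      CartesianMonoidalCategory.lift_snd]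
  inv_mem' := by
    rintro u ⟨v, rfl⟩
    obtain ⟨n, hn⟩ := D.inv_mem
    exact ⟨v ≫ n, by rw [Category.assoc, hn, GrpObj.comp_inv]⟩

variable {T}

/-- Membership in `Z(T)` unfolds to a factorisation through `ι`. [cite: GortzWedhorn2023, (27.1.1)] -/
theorem mem_points_iff (u : T ⟶ A.X) : u ∈ D.points T ↔ ∃ v : T ⟶ D.Z, v ≫ D.emb = u := Iff.rfl

/-- `v ≫ ι ∈ Z(T)`. [cite: GortzWedhorn2023, (27.1.1)] -/
theorem comp_emb_mem (v : T ⟶ D.Z) : v ≫ D.emb ∈ D.points T := ⟨v, rfl⟩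

/-- The factorisation of a point of `Z(T)` through `Z` (unique, `ι` being a monomorphism). [cite: GortzWedhorn2023, (27.1.1)] -/
def lift (P : D.points T) : T ⟶ D.Z := Classical.choose P.2

/-- `lift P ≫ ι = P`. [cite: GortzWedhorn2023, (27.1.1)] -/
@[reassoc (attr := simp)]
theorem lift_comp_emb (P : D.points T) : D.lift P ≫ D.emb = (P : T ⟶ A.X) := Classical.choose_spec P.2

/-- Uniqueness of the factorisation. [cite: GortzWedhorn2023, (27.1.1)] -/
theorem lift_eq_of_comp_emb_eq (P : D.points T) (v : T ⟶ D.Z) (hv : v ≫ D.emb = P) : D.lift P = v := by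
  haveI := D.mono_emb
  rw [← cancel_mono D.emb, lift_comp_emb, hv]

/-- `lift ⟨v ≫ ι, _⟩ = v`. [cite: GortzWedhorn2023, (27.1.1)] -/
@[simp]
theorem lift_comp_emb_mk (v : T ⟶ D.Z) : D.lift ⟨v ≫ D.emb, D.comp_emb_mem v⟩ = v :=
  D.lift_eq_of_comp_emb_eq _ v rfl

variable {T' : SchemeOver K}

/-- Precomposition with `g : T' → T` maps `Z(T)` to `Z(T')`, as a group homomorphism. [cite: GortzWedhorn2023, (27.1.1)] -/
def pointsComap (g : T' ⟶ T) : D.points T →* D.points T' where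
  toFun x := ⟨g ≫ x.1, by obtain ⟨v, hv⟩ := x.2; exact ⟨g ≫ v, by rw [Category.assoc, hv]⟩⟩
  map_one' := Subtype.ext (MonObj.comp_one g)
  map_mul' x y := Subtype.ext (MonObj.comp_mul g x.1 y.1)

/-- `pointsComap g x = g ≫ x` on underlying points. [cite: GortzWedhorn2023, (27.1.1)] -/
@[simp]
theorem coe_pointsComap (g : T' ⟶ T) (x : D.points T) : (D.pointsComap g x : T' ⟶ A.X) = g ≫ x := rfl

/-- Naturality of the factorisation: `lift (g ≫ P) = g ≫ lift P`. [cite: GortzWedhorn2023, (27.1.1)] -/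
theorem lift_comap (g : T' ⟶ T) (P : D.points T) : D.lift (D.pointsComap g P) = g ≫ D.lift P :=
  D.lift_eq_of_comp_emb_eq _ _ (by rw [Category.assoc, lift_comp_emb, coe_pointsComap])

end Points

/-! ### The affine algebra `Γ(Z, 𝒪)`, its points and the functorial group law -/

section Alg

/-- `Z` is affine (finite over `Spec K`). [cite: GortzWedhorn2023, §(27.2) (p. 606)] -/
theorem isAffine_left : IsAffine D.Z.left :=
  haveI := D.isFinite
  isAffine_of_isAffineHom D.Z.hom

/-- The affine algebra `Γ(Z, 𝒪)` of the finite subgroup scheme (a `def` carrier, so that its `K`-algebra instance below is attached to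
the datum only). [cite: GortzWedhorn2023, §(27.2) (p. 606)] -/
def Alg : Type u := Γ(D.Z.left, ⊤)

/-- The ring structure of `Γ(Z, 𝒪)`. [cite: GortzWedhorn2023, §(27.2) (p. 606)] -/
instance Alg.instCommRing : CommRing D.Alg := inferInstanceAs (CommRing Γ(D.Z.left, ⊤))

/-- `Γ(Z, 𝒪)` is a `K`-algebra through `algebraMapΓ (Z → Spec K)`. [cite: GortzWedhorn2023, §(27.2) (p. 606)] -/
instance Alg.instAlgebra : Algebra K D.Alg :=
  (Literature.AlgebraicGeometry.Motives.algebraMapΓ D.Z.hom).hom.toAlgebra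

/-- Unfolding the `K`-algebra structure of `Γ(Z, 𝒪)`. [cite: GortzWedhorn2023, §(27.2) (p. 606)] -/
theorem Alg.algebraMap_eq : algebraMap K D.Alg = (Literature.AlgebraicGeometry.Motives.algebraMapΓ D.Z.hom).hom := rfl

/-- `Γ(Z, 𝒪)` is a finite `K`-algebra (`Z → Spec K` finite). [cite: GortzWedhorn2023, §(27.2) (p. 606)] -/
instance Alg.moduleFinite : Module.Finite K D.Alg := by
  haveI := D.isFinite
  have h1 : D.Z.hom.appTop.hom.Finite := D.Z.hom.finite_appTop
  have h2 : (Scheme.ΓSpecIso (.of K)).inv.hom.Finite :=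
    RingHom.Finite.of_surjective _ fun y ↦ ⟨(Scheme.ΓSpecIso (.of K)).hom.hom y, by
      rw [← CommRingCat.comp_apply, Iso.hom_inv_id, CommRingCat.id_apply]⟩
  exact h1.comp h2

/-- `Γ(Z, 𝒪)` is a nontrivial ring: `Z` has a `K`-point (the unit). [cite: GortzWedhorn2023, §(27.2) (p. 606)] -/
instance Alg.nontrivial : Nontrivial D.Alg := by
  obtain ⟨e, -⟩ := D.one_mem
  exact (e.left.appTop ≫ (Scheme.ΓSpecIso (.of K)).hom).hom.domain_nontrivial

/-- **The ORDER of the finite subgroup scheme**: `n = dim_K Γ(Z, 𝒪)`. [cite: GortzWedhorn2023, §(27.2) (p. 606) and Prop. 27.86 (p. 633)] -/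
def order : ℕ := Module.finrank K D.Alg

/-- `0 < n`. [cite: GortzWedhorn2023, Prop. 27.86 (p. 633)] -/
theorem order_pos : 0 < D.order := Module.finrank_pos

variable {R' R'' : Type u} [CommRing R'] [Algebra K R'] [CommRing R''] [Algebra K R'']

variable (R') in
/-- **`Z(Spec R') ≃ Hom_{K-alg}(Γ(Z, 𝒪), R')`** for a commutative `K`-algebra `R'` (`Z ≅ Spec Γ(Z, 𝒪)` affine; ★ `specHomEquivUnderHom`,
★ `underHomEquivAlgHom`). [cite: GortzWedhorn2023, §(27.2) (p. 606)] -/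
def ptEquiv : D.points (specOver K R') ≃ (D.Alg →ₐ[K] R') :=
  haveI := D.isAffine_left
  (show D.points (specOver K R') ≃ {x : Spec (.of R') ⟶ D.Z.left // x ≫ D.Z.hom = Spec.map (CommRingCat.ofHom (algebraMap K R'))} from
    { toFun := fun P ↦ ⟨(D.lift P).left, Over.w (D.lift P)⟩
      invFun := fun x ↦ ⟨(Over.homMk x.1 x.2 : specOver K R' ⟶ D.Z) ≫ D.emb, D.comp_emb_mem _⟩
      left_inv := fun P ↦ Subtype.ext (by
        change (Over.homMk (D.lift P).left _ : specOver K R' ⟶ D.Z) ≫ D.emb = (P : specOver K R' ⟶ A.X)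
        rw [← D.lift_comp_emb P]; rfl)
      right_inv := fun x ↦ Subtype.ext (by
        change (D.lift ⟨(Over.homMk x.1 x.2 : specOver K R' ⟶ D.Z) ≫ D.emb, _⟩).left = x.1
        rw [lift_comp_emb_mk]; rfl) }).trans <|
    (Literature.AlgebraicGeometry.Motives.specHomEquivUnderHom D.Z.hom R').trans
      (Literature.AlgebraicGeometry.Motives.underHomEquivAlgHom (Literature.AlgebraicGeometry.Motives.algebraMapΓ D.Z.hom) R')

/-- The ring homomorphism underlying `ptEquiv P` is `Γ` of `Spec R' → Z ≅ Spec Γ(Z, 𝒪)` (as `Spec.preimage`).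
[cite: GortzWedhorn2023, §(27.2) (p. 606)] -/
theorem ofHom_ptEquiv (P : D.points (specOver K R')) :
    haveI := D.isAffine_left
    CommRingCat.ofHom (D.ptEquiv R' P).toRingHom = Spec.preimage ((D.lift P).left ≫ D.Z.left.isoSpec.hom) :=
  rfl

/-- Naturality of `ptEquiv` in `R'`, on underlying morphisms of `CommRingCat`. [cite: GortzWedhorn2023, §(27.2) (p. 606)] -/
theorem preimage_lift_comap (ψ : R' →ₐ[K] R'') (P : D.points (specOver K R')) :
    haveI := D.isAffine_left
    Spec.preimage ((D.lift (D.pointsComap (AlgPoints.specOverMapOfAlgHom ψ) P)).left ≫ D.Z.left.isoSpec.hom) =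
      Spec.preimage ((D.lift P).left ≫ D.Z.left.isoSpec.hom) ≫ CommRingCat.ofHom ψ.toRingHom := by
  haveI := D.isAffine_left
  apply Spec.map_injective
  simp only [Spec.map_comp, Spec.map_preimage, lift_comap, Over.comp_left, AlgPoints.specOverMapOfAlgHom_left]
  exact Category.assoc _ _ _

/-- **Naturality of `ptEquiv`** in the `K`-algebra `R'`. [cite: GortzWedhorn2023, §(27.2) (p. 606)] -/
theorem ptEquiv_comap (ψ : R' →ₐ[K] R'') (P : D.points (specOver K R')) :
    D.ptEquiv R'' (D.pointsComap (AlgPoints.specOverMapOfAlgHom ψ) P) = ψ.comp (D.ptEquiv R' P) := by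
  haveI := D.isAffine_left
  apply AlgHom.coe_ringHom_injective
  change (Spec.preimage ((D.lift (D.pointsComap (AlgPoints.specOverMapOfAlgHom ψ) P)).left ≫ D.Z.left.isoSpec.hom)).hom =
    (Spec.preimage ((D.lift P).left ≫ D.Z.left.isoSpec.hom) ≫ CommRingCat.ofHom ψ.toRingHom).hom
  rw [preimage_lift_comap]

/-- **The functorial group law on the points of `Spec Γ(Z, 𝒪) ≅ Z`**, transported from `Z(Spec R') ≤ A(Spec R')` along `ptEquiv`
([GortzWedhorn2023] §(27.2): a subgroup functor represented by an affine scheme). [cite: GortzWedhorn2023, §(27.2) (pp. 606–607)] -/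
def groupLaw : CorepGroupLaw K D.Alg where
  mul := fun R' _ _ φ χ ↦ D.ptEquiv R' ((D.ptEquiv R').symm φ * (D.ptEquiv R').symm χ)
  one := fun R' _ _ ↦ D.ptEquiv R' 1
  inv := fun R' _ _ φ ↦ D.ptEquiv R' ((D.ptEquiv R').symm φ)⁻¹
  mul_assoc x y z := by simp only [Equiv.symm_apply_apply, mul_assoc]
  one_mul x := by simp only [Equiv.symm_apply_apply, one_mul, Equiv.apply_symm_apply]
  inv_mul x := by simp only [Equiv.symm_apply_apply, inv_mul_cancel]
  comp_mul ψ x y := by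
    obtain ⟨a, rfl⟩ := (D.ptEquiv _).surjective x
    obtain ⟨b, rfl⟩ := (D.ptEquiv _).surjective y
    simp only [Equiv.symm_apply_apply, ← ptEquiv_comap, _root_.map_mul]
  comp_one ψ := by rw [← ptEquiv_comap, _root_.map_one]

/-- The product of the group law is the product of points of `A`. [cite: GortzWedhorn2023, §(27.2) (pp. 606–607)] -/
theorem groupLaw_mul_apply (x y : D.points (specOver K R')) :
    D.groupLaw.mul (D.ptEquiv R' x) (D.ptEquiv R' y) = D.ptEquiv R' (x * y) := by
  change D.ptEquiv R' ((D.ptEquiv R').symm (D.ptEquiv R' x) * (D.ptEquiv R').symm (D.ptEquiv R' y)) = _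
  rw [Equiv.symm_apply_apply, Equiv.symm_apply_apply]

/-- **The Hopf algebra of the finite subgroup scheme**: `Γ(Z, 𝒪)` is a commutative Hopf `K`-algebra (★ `CorepGroupLaw.toHopfAlgebra`).
[cite: GortzWedhorn2023, §(27.2) (pp. 606–607)] -/
instance Alg.instHopfAlgebra : HopfAlgebra K D.Alg := D.groupLaw.toHopfAlgebra

/-- It is cocommutative (`A` is commutative). [cite: GortzWedhorn2023, §(27.2) (p. 607)] -/
instance Alg.isCocomm : Coalgebra.IsCocomm K D.Alg :=
  D.groupLaw.isCocomm fun x y ↦ by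
    obtain ⟨a, rfl⟩ := (D.ptEquiv _).surjective x
    obtain ⟨b, rfl⟩ := (D.ptEquiv _).surjective y
    rw [groupLaw_mul_apply, groupLaw_mul_apply, mul_comm]

variable (R') in
/-- **Points of `Z` multiply by convolution**: the injective monoid homomorphism `Z(Spec R') → (Hom_{K-alg}(Γ(Z, 𝒪), R'), ⋆)`.
[cite: GortzWedhorn2023, §(27.2) (pp. 606–607)] -/
def ptConv : D.points (specOver K R') →* WithConv (D.Alg →ₐ[K] R') where
  toFun u := toConv (D.ptEquiv R' u)
  map_one' := by
    change toConv (D.groupLaw.one R') = 1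
    exact D.groupLaw.toConv_one
  map_mul' u v := by
    change toConv (D.ptEquiv R' (u * v)) = toConv (D.ptEquiv R' u) * toConv (D.ptEquiv R' v)
    rw [← groupLaw_mul_apply]
    exact D.groupLaw.toConv_mul _ _

variable (R') in
/-- `ptConv` is injective. [cite: GortzWedhorn2023, §(27.2) (p. 606)] -/
theorem ptConv_injective : Function.Injective (D.ptConv R') := fun _ _ h ↦
  (D.ptEquiv R').injective (WithConv.toConv_injective h)

/-- **DELIGNE՚s theorem for the finite subgroup scheme**: every `Spec R'`-valued point `u` of `Z` satisfies `u ^ n = 1` in `A(Spec R')`,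
`n = dim_K Γ(Z, 𝒪)` (★ `Deligne.convPow_finrank_eq_one`). [cite: GortzWedhorn2023, Prop. 27.86 (p. 633)] -/
theorem pt_pow_order (u : D.points (specOver K R')) : u ^ D.order = 1 :=
  D.ptConv_injective R' <| by
    rw [_root_.map_pow, _root_.map_one]
    exact Deligne.convPow_finrank_eq_one _

end Alg

/-! ### The universal point: `ι ^ n = 1`, `Z ⊆ A[n]` -/

section Universal

/-- `Spec Γ(Z, 𝒪) → Z` as a morphism of `K`-schemes. [cite: GortzWedhorn2023, §(27.2) (p. 606)] -/
def specAlgToZ : specOver K D.Alg ⟶ D.Z :=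
  haveI := D.isAffine_left
  Over.homMk D.Z.left.isoSpec.inv
    ((Iso.inv_comp_eq _).mpr (Literature.AlgebraicGeometry.Motives.isoSpec_hom_comp_SpecMap_algebraMapΓ D.Z.hom).symm)

/-- `Z → Spec Γ(Z, 𝒪)` as a morphism of `K`-schemes. [cite: GortzWedhorn2023, §(27.2) (p. 606)] -/
def zToSpecAlg : D.Z ⟶ specOver K D.Alg :=
  haveI := D.isAffine_left
  Over.homMk D.Z.left.isoSpec.hom (Literature.AlgebraicGeometry.Motives.isoSpec_hom_comp_SpecMap_algebraMapΓ D.Z.hom)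

/-- `Z → Spec Γ(Z, 𝒪) → Z` is the identity. [cite: GortzWedhorn2023, §(27.2) (p. 606)] -/
@[reassoc]
theorem zToSpecAlg_comp : D.zToSpecAlg ≫ D.specAlgToZ = 𝟙 _ :=
  haveI := D.isAffine_left
  Over.OverMorphism.ext D.Z.left.isoSpec.hom_inv_id

/-- **The inclusion `ι : Z ↪ A`, as a `Z`-valued point of `A`, has order dividing `n = dim_K Γ(Z, 𝒪)`** (Deligne at the universal point,
over `R' = Γ(Z, 𝒪)`). [cite: GortzWedhorn2023, Prop. 27.86 (p. 633)] -/
theorem emb_pow_order : D.emb ^ D.order = 1 := by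
  have h1 : D.emb = D.zToSpecAlg ≫ (D.specAlgToZ ≫ D.emb) := by rw [zToSpecAlg_comp_assoc]
  have h2 : (D.specAlgToZ ≫ D.emb) ^ D.order = 1 := by
    simpa using congrArg Subtype.val (D.pt_pow_order ⟨D.specAlgToZ ≫ D.emb, D.comp_emb_mem _⟩)
  rw [h1, ← MonObj.comp_pow, h2, MonObj.comp_one]

/-- **Every `T`-valued point of `Z` is killed by `n` in `A(T)`.** [cite: GortzWedhorn2023, Prop. 27.86 (p. 633)] -/
theorem comp_emb_pow_order {T : SchemeOver K} (v : T ⟶ D.Z) : (v ≫ D.emb) ^ D.order = 1 := by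
  rw [← MonObj.comp_pow, D.emb_pow_order, MonObj.comp_one]

/-- **`Z(T) ⊆ A[n](T)` for every `K`-scheme `T`**, `n` the order of `Z` ([GortzWedhorn2023] Prop. 27.86 with (27.35.2)).
[cite: GortzWedhorn2023, Prop. 27.86 (p. 633)] -/
theorem points_le_kerPoints_nsmul (T : SchemeOver K) : D.points T ≤ Hom.kerPoints T (D.order • 𝟙 A) := by
  rintro u ⟨v, rfl⟩
  exact (mem_kerPoints_nsmul_iff _ _).mpr (D.comp_emb_pow_order v)

end Universal

end FiniteSubgroupSubscheme

end Literature.AlgebraicGeometry.Motives.AbelianVariety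

end
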